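import Literature.MathematicalPhysics.QuantumFieldTheory.BalabanImbrieJaffe1984to88.BIJ85AxialMinimizer413
import Literature.MathematicalPhysics.QuantumFieldTheory.Balaban1983to89.B5Positivity172Lattice

/-!
# `BalabanImbrieJaffe1984to88.BIJ85NoZeroModes309Torus` — T. Bałaban, J. Imbrie, A. Jaffe, *Renormalization of the Higgs
model: minimizers, propagators and the stability of mean field theory*, Commun. Math. Phys. **97** (1985) 299–329
[BalabanImbrieJaffe1985]: the «no zero modes» claim of Sect. 4.1, p. 309, ON THE TORUS CARRIER OF RECORD and for EVERY k —
PROVED; hence (4.1.1), (4.1.4) > 0 and (4.1.5) on the tori hold WITHOUT the standing hypothesis `hD`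

statement-level skeleton of published theorems with citation tags; proofs where landed; nothing here is a claim about the Yang–Mills mass gap

PDF held: `paper:balaban1985-cmp97-bij-higgs-minimizers` (journal page = PDF page + 298); p. 309 [PDF 11] re-read by this seat on the
store's text layer (`lit read … --pages 11`), lines 26–34.

THE PRINTED TEXT (p. 309, verbatim).  *"The reader may wonder whether ∂ has zero modes on the subspace of gauge fields satisfying
Q_kA = 0 and satisfying the axial gauge condition. Such zero modes do not occur, and as a consequence the integral (4.1.1) is
convergent also for noncompact gauge fields. A proof of this fact for k = 1 follows by considering on each plaquette in a lattice
block the condition dA = 0 and the axial gauge condition. This shows that A can be nonzero only on bonds connecting different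
blocks, and it must be constant on the bonds connecting two given blocks. The condition QA = 0 then ensures that A is everywhere
zero. Similar, elementary reasoning yields an inductive proof for k > 1, but we leave out the details."*

CITATION HEADER (lean-in-tree rule).  Phase-2 proof seat p33 (gen 2) of the mega-formalization `lit-balaban` (HOME
`run/shared/lean/pub/lit-balaban/`), SKELETON row **C1.Claim@309** (fold owner r15) — now on the TORUS carrier of the series'
lattice calculus `…Balaban1983to89.LatticeFieldCalculus` (tori `Setup.Site P j`, centred blocks, `Q = bondAvg` = (2.13) =
[Balaban1984PropagatorsI] (1.11), `Q_k = bondAvgIter k`, `Q'_k = siteAvgIter k`, axial gauge `IsAxial` = (3.4), `∂ = curl c`), i.e.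
exactly the hypothesis
`hD : ∀ A : VecField P 0 ℝ, A ∈ constraint411 k → (∀ p, curl c A p = 0) → A = 0`
that `…BIJ85AxialPropagator411.eq411_torus` ((4.1.1) on the torus, seat p09), `…BIJ85AxialMinimizer413.torus_eq415` /
`torus_minimizes` / `torusZax_pos` ((4.1.3)–(4.1.5), p09) and, downstream, `…BIJ85Eq531Proof.eq531_torus` ((5.3.1), p30),
`…BIJ85Sigma421Torus` (σ_k, p30), `…BIJ85Prop521Torus` ((5.2.1), p09) carry verbatim.  The gen-1 files of this seat proved the
claim on the corner-block carriers of ℤ^d following the printed k = 1 block argument (`…BIJ85NoZeroModes309Proof.noZeroModes_k1`,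
p243150) and the induction the paper leaves out (`…BIJ85NoZeroModes309KProof.noZeroModes`, p244106); the torus instance was read
there only on representatives for k = 1 (`noZeroModes_k1_periodic`).

WHAT IS PROVED HERE, and the route (a genuinely shorter road than re-running the block argument on the torus, using two steps the
tree already holds — said here per the cell's rule; the printed k = 1 argument is the gen-1 file):
* §1 — an AXIAL GRADIENT IS A BLOCK CONSTANT: if `∂ψ` (lattice factor `c ≠ 0`) satisfies the axial gauge (3.4) on `T^{(j)}`, then
  `ψ(x) = ψ(y)` for every `x ∈ B(y)` (telescoping of `∂ψ` along `Γ_{y,x}`, the tree's `B5Eq120IterProof.stairSum_grad` =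
  [Balaban1984PropagatorsI] (1.9)), so `Q'ψ(y) = ψ(y)` and `ψ = (Q'ψ) ∘ blockOf` (`apply_blockSite_eq_apply_emb`,
  `siteAvg_eq_apply_emb`, `apply_eq_siteAvg_blockOf`; standing range `j + 1 ≤ m + K`).
* §2 — THE INDUCTION IN k (*"an inductive proof for k > 1"*): if `δ_{k,Ax}(∂φ)` — i.e. `Q_j∂φ = ∂_{(j)}Q'_jφ` ((1.20),
  `B5Eq120IterProof.bondAvgIter_grad`) is axial for every `j < k` — and `Q'_kφ = 0`, then `φ = 0`: by §1 at level `k − 1`,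
  `Q'_{k−1}φ = (Q'_kφ) ∘ blockOf = 0`, and so on down to `φ = Q'_0φ = 0` (`eq_zero_of_deltaAx_grad`).
* §3 — **THE CLAIM ON THE TORUS, EVERY k** (`noZeroModes_torus`): `A ∈ constraint411 k` (i.e. `Q_kA = 0 ∧ δ_{k,Ax}(A)`) and
  `∂A = 0` force `A = 0`, in the standing range `k ≤ m + K`, `c ≠ 0`.  The step *"∂A = 0 ∧ Q_kA = 0 ⇒ A = ∂φ with Q'_kφ = 0"* is
  the torus Poincaré lemma in the form of [Balaban1984PropagatorsI] p. 30 after (1.72), PROVED on this carrier by seat p11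
  (`…B5Positivity172Lattice.exists_grad_of_curl_eq_zero_of_bondAvgIter_eq_zero`); §2 finishes.  Forms: the spelled-out
  `noZeroModes_torus'` (hypotheses `Q_kA = 0`, `deltaAx k A`, `∂A = 0`), the injectivity form `eq_of_curl_eq_torus` (two fields
  of one constraint class with equal plaquette variables coincide), the transported form `noZeroModes_V411_holds` on the Euclidean
  space `BondSpace P` (= p09's `noZeroModes_V411` with `hD` discharged), and `hD_holds` — the hypothesis itself, as a theorem.
* §4 — THE TORUS STATEMENTS OF p09 WITHOUT `hD`: **(4.1.1)** `eq411_torus_holds` (*"the integral (4.1.1) is convergent also for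
  noncompact gauge fields"*: `Z_{k,Ax} > 0` is its second conjunct), **(4.1.5)** `torus_eq415_holds`, the minimizing property
  `torus_minimizes_holds`, **(4.1.4) > 0** `torusZax_pos_holds` — each a one-line application of p09's theorem to `hD_holds`.
Standing hypotheses, all displayed: `k ≤ m + K` (the block geometry of `Setup` is exact there — every torus file of the series
carries it), `c ≠ 0` (the lattice factor inside `∂`; in print `c = η⁻¹`), `w > 0` where a weight enters (in print `w = η^d`).
NOT DONE HERE: the downstream restatements ((5.3.1), σ_k, (5.2.1)) — their seats apply `hD_holds` in one line; nothing of
`Summits/` is touched; no new `def … : Prop`.  Axioms of every theorem: {propext, Classical.choice, Quot.sound}.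
Unit `lit-balaban-p33` gen 2 (literature-prover-lit-balaban-p33-g2-0), 2026-08-21.
-/

namespace Literature.MathematicalPhysics.QuantumFieldTheory.BalabanImbrieJaffe1984to88.BIJ85NoZeroModes309Torus

open Literature.MathematicalPhysics.QuantumFieldTheory.Balaban1983to89
open LatticeFieldCalculus BIJ85AxialPropagator411 BIJ85AxialMinimizer413

noncomputable section

variable {P : Params}

/-! ## §1  An axial gradient is a block constant (*"it must be constant on …"*, p. 309; telescoping (1.9) of [6I]) -/

section BlockConstant

variable {j : ℕ} {V : Type*} [AddCommGroup V] [Module ℝ V]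

/-- If `∂ψ` (lattice factor `c ≠ 0`) is in the axial gauge (3.4) on `T^{(j)}`, then `ψ` takes at every site `x ∈ B(y)` its value
at the centre `y`: `(∂ψ)(Γ_{y,x}) = c·(ψ(x) − ψ(y)) = 0`. [cite: BalabanImbrieJaffe1985, §4.1 p.309] -/
theorem apply_blockSite_eq_apply_emb {c : ℝ} (hc : c ≠ 0) {ψ : SiteField P j V} (hAx : IsAxial (grad c ψ))
    (y : Site P (j + 1)) (r : Fin P.d → Fin P.L) : ψ (Site.blockSite y r) = ψ (emb y) := by
  by_cases h : Site.blockSite y r = emb y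
  · rw [h]
  · have h1 := hAx y r h
    rw [B5Eq120IterProof.stairSum_grad] at h1
    have h2 : ψ (Site.blockSite y r) - ψ (emb y) = 0 := by
      have h3 := congrArg (fun v : V => c⁻¹ • v) h1
      simp only [smul_zero, inv_smul_smul₀ hc] at h3
      exact h3
    exact sub_eq_zero.1 h2

/-- … hence its block average is that value: `(Q'ψ)(y) = ψ(y)`. [cite: BalabanImbrieJaffe1985, §4.1 p.309] -/
theorem siteAvg_eq_apply_emb {c : ℝ} (hc : c ≠ 0) {ψ : SiteField P j V} (hAx : IsAxial (grad c ψ))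
    (y : Site P (j + 1)) : siteAvg ψ y = ψ (emb y) := by
  have h : siteAvg ψ y = siteAvg (fun _ : Site P j => ψ (emb y)) y := by
    simp only [siteAvg, apply_blockSite_eq_apply_emb hc hAx y]
  rw [h, siteAvg_const]

/-- … and `ψ` IS the block constant `(Q'ψ) ∘ blockOf` (standing range `j + 1 ≤ m + K`, where every site is `blockSite (blockOf x) r`).
[cite: BalabanImbrieJaffe1985, §4.1 p.309] -/
theorem apply_eq_siteAvg_blockOf (hj : j + 1 ≤ P.m + P.K) {c : ℝ} (hc : c ≠ 0) {ψ : SiteField P j V}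
    (hAx : IsAxial (grad c ψ)) (x : Site P j) : ψ x = siteAvg ψ (blockOf x) := by
  set e := Site.blockEquiv hj (blockOf x) with he
  have hr : Site.blockSite (blockOf x) (e ⟨x, rfl⟩) = x := by
    have h := e.symm_apply_apply ⟨x, rfl⟩
    exact congrArg Subtype.val h
  calc ψ x = ψ (Site.blockSite (blockOf x) (e ⟨x, rfl⟩)) := by rw [hr]
    _ = ψ (emb (blockOf x)) := apply_blockSite_eq_apply_emb hc hAx _ _
    _ = siteAvg ψ (blockOf x) := (siteAvg_eq_apply_emb hc hAx _).symm

/-- The function form of the previous statement: `ψ = (Q'ψ) ∘ blockOf`. [cite: BalabanImbrieJaffe1985, §4.1 p.309] -/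
theorem eq_siteAvg_comp_blockOf (hj : j + 1 ≤ P.m + P.K) {c : ℝ} (hc : c ≠ 0) {ψ : SiteField P j V}
    (hAx : IsAxial (grad c ψ)) : ψ = siteAvg ψ ∘ blockOf :=
  funext fun x => apply_eq_siteAvg_blockOf hj hc hAx x

end BlockConstant

/-! ## §2  The induction in k (*"Similar, elementary reasoning yields an inductive proof for k > 1"*, p. 309) -/

section Induction

variable {V : Type*} [AddCommGroup V] [Module ℝ V]

/-- **The inductive step, iterated**: a site function `φ` on the η-lattice whose gradient satisfies the k-th axial gauge condition
`δ_{k,Ax}(∂φ)` ((4.1.2): `Q_j∂φ = ∂_{(j)}Q'_jφ` axial for all `j < k`) and whose k-fold average vanishes, `Q'_kφ = 0`, is zero —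
level `k − 1` is the block constant `(Q'_kφ) ∘ blockOf = 0` by §1, and so on down to `φ = Q'_0φ` (standing range `k ≤ m + K`, `c ≠ 0`).
[cite: BalabanImbrieJaffe1985, (4.1.2) p.309] -/
theorem eq_zero_of_deltaAx_grad {c : ℝ} (hc : c ≠ 0) :
    ∀ (k : ℕ), k ≤ P.m + P.K → ∀ (φ : SiteField P 0 V),
      (∀ j, j < k → IsAxial (bondAvgIter j (grad c φ))) → siteAvgIter k φ = 0 → φ = 0
  | 0, _, _, _, hQ => hQ
  | k + 1, hk, φ, hAx, hQ => by
    have hL : (P.L : ℝ) ≠ 0 := Nat.cast_ne_zero.mpr P.L_pos.ne'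
    have hck : c / (P.L : ℝ) ^ k ≠ 0 := div_ne_zero hc (pow_ne_zero _ hL)
    have hk' : k ≤ P.m + P.K := Nat.le_of_succ_le hk
    -- `Q_k∂φ = ∂_{(k)}Q'_kφ` is axial on `T^{(k)}`
    have hAxk : IsAxial (grad (c / (P.L : ℝ) ^ k) (siteAvgIter k φ)) := by
      rw [← B5Eq120IterProof.bondAvgIter_grad k hk' c φ]
      exact hAx k (Nat.lt_succ_self k)
    -- hence `Q'_kφ = (Q'_{k+1}φ) ∘ blockOf = 0`
    have hψ : siteAvgIter k φ = 0 := by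
      funext x
      rw [apply_eq_siteAvg_blockOf hk hck hAxk x, ← B5Eq120IterProof.siteAvgIter_succ, hQ]
      rfl
    exact eq_zero_of_deltaAx_grad hc k hk' φ (fun j hj => hAx j (Nat.lt_succ_of_lt hj)) hψ

/-- The same with the (4.1.2) predicate `deltaAx` of `…BIJ85AxialPropagator411`: `δ_{k,Ax}(∂φ) ∧ Q'_kφ = 0 ⇒ φ = 0`.
[cite: BalabanImbrieJaffe1985, (4.1.2) p.309] -/
theorem eq_zero_of_deltaAx_grad' {k : ℕ} (hk : k ≤ P.m + P.K) {c : ℝ} (hc : c ≠ 0) {φ : SiteField P 0 V}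
    (hAx : deltaAx k (grad c φ)) (hQ : siteAvgIter k φ = 0) : φ = 0 :=
  eq_zero_of_deltaAx_grad hc k hk φ hAx hQ

end Induction

/-! ## §3  The claim on the torus: no zero modes of ∂ on `{Q_kA = 0} ∩ δ_{k,Ax}`, every k -/

section Claim

/-- **The «no zero modes» claim of p. 309 on the torus, for every k** (verbatim: *"The reader may wonder whether ∂ has zero modes on
the subspace of gauge fields satisfying Q_kA = 0 and satisfying the axial gauge condition. Such zero modes do not occur"*): on the
η-lattice bond fields of the tori of `LatticeFieldCalculus`, `A ∈ constraint411 k` (`Q_kA = 0 ∧ δ_{k,Ax}(A)`) and `∂A = 0` force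
`A = 0` — typed reading: the hypothesis `hD` of `…BIJ85AxialPropagator411.eq411_torus`, as a theorem; standing range `k ≤ m + K`,
lattice factor `c ≠ 0`.  Route: `A = ∂φ` with `Q'_kφ = 0` ([Balaban1984PropagatorsI] p. 30, the tree's
`B5Positivity172Lattice.exists_grad_of_curl_eq_zero_of_bondAvgIter_eq_zero`), then §2. [cite: BalabanImbrieJaffe1985, §4.1 p.309] -/
theorem noZeroModes_torus {k : ℕ} (hk : k ≤ P.m + P.K) {c : ℝ} (hc : c ≠ 0) (A : VecField P 0 ℝ)
    (hA : A ∈ (constraint411 k : Submodule ℝ (VecField P 0 ℝ))) (hcurl : ∀ p, curl c A p = 0) : A = 0 := by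
  obtain ⟨hQ, hAx⟩ := (mem_constraint411 k A).1 hA
  have hcurl' : curl c A = 0 := funext fun p => hcurl p
  obtain ⟨φ, hφ, rfl⟩ :=
    B5Positivity172Lattice.exists_grad_of_curl_eq_zero_of_bondAvgIter_eq_zero hk hc hcurl' hQ
  have h0 : φ = 0 := eq_zero_of_deltaAx_grad hc k hk φ hAx hφ
  rw [h0]
  funext b
  simp [grad]

/-- The claim spelled out: `∂A = 0 ∧ δ_{k,Ax}(A) ∧ Q_kA = 0 ⇒ A = 0` on the torus (every k ≤ m + K, `c ≠ 0`).
[cite: BalabanImbrieJaffe1985, §4.1 p.309] -/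
theorem noZeroModes_torus' {k : ℕ} (hk : k ≤ P.m + P.K) {c : ℝ} (hc : c ≠ 0) (A : VecField P 0 ℝ)
    (hcurl : ∀ p, curl c A p = 0) (hAx : deltaAx k A) (hQ : bondAvgIter k A = 0) : A = 0 :=
  noZeroModes_torus hk hc A ((mem_constraint411 k A).2 ⟨hQ, hAx⟩) hcurl

/-- **The hypothesis `hD` of p09's torus files, as a theorem** (exactly its displayed shape). [cite: BalabanImbrieJaffe1985, §4.1 p.309] -/
theorem hD_holds {k : ℕ} (hk : k ≤ P.m + P.K) {c : ℝ} (hc : c ≠ 0) :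
    ∀ A : VecField P 0 ℝ, A ∈ (constraint411 k : Submodule ℝ (VecField P 0 ℝ)) → (∀ p, curl c A p = 0) → A = 0 :=
  fun A hA hcurl => noZeroModes_torus hk hc A hA hcurl

/-- Injectivity form: two bond fields of one constraint class (`A − A' ∈ constraint411 k`) with the same plaquette variables
coincide — ∂ restricted to `{Q_kA = B} ∩ δ_{k,Ax}` is one-to-one. [cite: BalabanImbrieJaffe1985, §4.1 p.309] -/
theorem eq_of_curl_eq_torus {k : ℕ} (hk : k ≤ P.m + P.K) {c : ℝ} (hc : c ≠ 0) {A A' : VecField P 0 ℝ}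
    (hAA' : A - A' ∈ (constraint411 k : Submodule ℝ (VecField P 0 ℝ))) (hcurl : ∀ p, curl c A p = curl c A' p) :
    A = A' := by
  have h : A - A' = 0 := by
    refine noZeroModes_torus hk hc (A - A') hAA' fun p => ?_
    have := curl_sub c A A' p
    rw [hcurl p, sub_self] at this
    exact this
  exact sub_eq_zero.1 h

/-- The claim transported to the Euclidean space `BondSpace P` of `…BIJ85AxialPropagator411` §4: `∂` (as `curlOp w c`, `w > 0`)
has no zero modes on `V411 P k` — p09's `noZeroModes_V411` with `hD` discharged. [cite: BalabanImbrieJaffe1985, §4.1 p.309] -/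
theorem noZeroModes_V411_holds {k : ℕ} (hk : k ≤ P.m + P.K) {w : ℝ} (hw : 0 < w) {c : ℝ} (hc : c ≠ 0)
    (v : V411 P k) (hv : curlOp (P := P) w c (v : BondSpace P) = 0) : v = 0 :=
  noZeroModes_V411 hw c k (hD_holds hk hc) v hv

end Claim

/-! ## §4  (4.1.1), (4.1.4), (4.1.5) on the torus without the hypothesis `hD` -/

section Consequences

/-- **(4.1.1) on the torus, unconditionally** (*"Such zero modes do not occur, and as a consequence the integral (4.1.1) is
convergent also for noncompact gauge fields"*): for every source J,
`exp(½⟨J, G_{k,Ax}J⟩) = Z_{k,Ax}⁻¹ ∫_{Q_kA = 0, δ_{k,Ax}(A)} exp(−½‖∂A‖² + ⟨A, J⟩) dA` and `Z_{k,Ax} > 0` — p09's `eq411_torus`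
with `hD` discharged (standing range `k ≤ m + K`, `w > 0`, `c ≠ 0`). [cite: BalabanImbrieJaffe1985, (4.1.1) p.309] -/
theorem eq411_torus_holds {k : ℕ} (hk : k ≤ P.m + P.K) {w : ℝ} (hw : 0 < w) {c : ℝ} (hc : c ≠ 0) (J : VecField P 0 ℝ) :
    Real.exp ((1 / 2) * bondPairing w J (torusPropagator w c k J)) =
        (Z (V411 P k) (curlOp (P := P) w c))⁻¹ *
          ∫ v : V411 P k, Real.exp (-curlAction w c ((toE P).symm (v : BondSpace P)) +
            bondPairing w ((toE P).symm (v : BondSpace P)) J) ∧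
      0 < Z (V411 P k) (curlOp (P := P) w c) :=
  eq411_torus hw c k (hD_holds hk hc) J

/-- *"the integral (4.1.1) is convergent"*: `0 < Z_{k,Ax} (< ∞)` on the torus, unconditionally. [cite: BalabanImbrieJaffe1985, (4.1.1) p.309] -/
theorem Z_torus_pos {k : ℕ} (hk : k ≤ P.m + P.K) {w : ℝ} (hw : 0 < w) {c : ℝ} (hc : c ≠ 0) :
    0 < Z (V411 P k) (curlOp (P := P) w c) :=
  (eq411_torus_holds hk hw hc 0).2

/-- **(4.1.5) on the torus, unconditionally**: `Q_k(H_{k,Ax}B) = B` and `H_{k,Ax}B` keeps the axial gauge conditions of the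
representative — p09's `torus_eq415` with `hD` discharged. [cite: BalabanImbrieJaffe1985, (4.1.5) p.310] -/
theorem torus_eq415_holds {k : ℕ} (hk : k ≤ P.m + P.K) {w : ℝ} (hw : 0 < w) {c : ℝ} (hc : c ≠ 0) (A₀ : VecField P 0 ℝ) :
    bondAvgIter k (torusHax w c k A₀) = bondAvgIter k A₀ ∧ (deltaAx k A₀ → deltaAx k (torusHax w c k A₀)) :=
  torus_eq415 hw c k (hD_holds hk hc) A₀

/-- The minimizing property of `H_{k,Ax}` on the torus, unconditionally — p09's `torus_minimizes` with `hD` discharged.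
[cite: BalabanImbrieJaffe1985, (4.1.3) p.310] -/
theorem torus_minimizes_holds {k : ℕ} (hk : k ≤ P.m + P.K) {w : ℝ} (hw : 0 < w) {c : ℝ} (hc : c ≠ 0)
    (A₀ : VecField P 0 ℝ) {A : VecField P 0 ℝ} (hA : A - A₀ ∈ (constraint411 k : Submodule ℝ (VecField P 0 ℝ))) :
    curlAction w c (torusHax w c k A₀) ≤ curlAction w c A :=
  torus_minimizes hw c k (hD_holds hk hc) A₀ hA

/-- `Z_{k,Ax}(B) > 0` ((4.1.4)) on the torus, unconditionally — p09's `torusZax_pos` with `hD` discharged.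
[cite: BalabanImbrieJaffe1985, (4.1.4) p.310] -/
theorem torusZax_pos_holds {k : ℕ} (hk : k ≤ P.m + P.K) {w : ℝ} (hw : 0 < w) {c : ℝ} (hc : c ≠ 0) (A₀ : VecField P 0 ℝ) :
    0 < torusZax w c k A₀ :=
  torusZax_pos hw c k (hD_holds hk hc) A₀

end Consequences

end

end Literature.MathematicalPhysics.QuantumFieldTheory.BalabanImbrieJaffe1984to88.BIJ85NoZeroModes309Torus
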